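import Summits.BirchSwinnertonDyer.BirchSwinnertonDyer.Theorems.RamifiedHeegnerPairGss2LowerAtThreeRankOneMcCallumRoad
import Summits.BirchSwinnertonDyer.Rank1Residual.Additive.LocIrrOddPrimes
import Literature.NumberTheory.EllipticCurves.MatarNekovar2019.ShaStructureIrreducible
import HarnessLib

/-!
# Route `RamifiedHeegnerPair`, crux L₁ `Gss2LowerAtThreeRankOne` (stmt-BirchSwinnertonDyer-26021) — the IRREDUCIBLE-IMAGE
# road: the declared residual NT (27201, the `3Nn` rows) follows from the tree's CITED structure theorem under
# irreducibility (Matar–Nekovář 2019 Thm. 0.7 / §0.11, `MatarNekovar2019.thm07_pow_dvd_card_sha_primary_of_certificate_of_irreducible`),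
# ONE derived-point certificate per `3Nn` row, and the route's own member U₀ `LeafRankZeroUpperAtThree` (26024) for the twist

HONEST FRAMING. Theorems only (no definition, no named fact, no `sorry`); ROUTE-INDEPENDENT helper file (no Theses import;
`--supports stmt-BirchSwinnertonDyer-27201`); nothing is booked, no item is closed, BSD is not proved for any curve; every displayed
input is a hypothesis. PART 1 of 2 (§5–§8, the doors); the BY-NAME readings §9–§10 are the sibling `…IrreducibleRoadByName.lean`. Lead prover bsd-line-rhp-p1 g5, 2026-08-28. Sequel of `…McCallumRoad.lean` (p618012, §11–§13: the road on the
3-adic-TOWER rows) and `…NonTowerOfNonSurjThree.lean` (p622801/p623293: the non-tower rows are EXACTLY the `3Nn` rows,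
`E[3]` irreducible there).

WHY THIS FILE. The McCallum road (p618012 §11) uses the 3-adic tower at exactly TWO places: (i) Kolyvagin's structure
theorem is consumed as the fact `McCallum1991_pow_dvd_card_sha_primary_of_certificate`, whose image binder is `∀ n, ρ̄_{E,3ⁿ}`
onto; (ii) the UPPER half of the rank-`0` twist `Wd = E^{(d_{K′})}` is Kato 2004 Thm. 14.5 (3) + Prop. 14.16 (2) Tamagawa-exact
under (12.5.2) `SL₂(ℤ₃) ⊆ image` — both impossible on the `3Nn` rows (`EulerSystemBigImageBarrier`,
`katoBigImageHypothesis_iff_surj_three_of_subGss`). But (i) has an IRREDUCIBLE-image sibling ALREADY IN THE TREE, gate-accepted: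
`MatarNekovar2019.thm07_pow_dvd_card_sha_primary_of_certificate_of_irreducible` (cell bsd-potss; Matar–Nekovář 2019 Thm. 0.7
read through §0.11 «the conclusions of Theorems 0.3 and 0.7 hold (for `D_K ≠ −3, −4`) if `ρ̄_{E,p}` is irreducible and
`p ≠ 2`»; Cha 2005 Rmk. 25; binders = the McCallum fact's VERBATIM with the tower replaced by `E[p]` irreducible; NO reduction
binder at `p`; referee flags `MN19-0.11-structure-composite` / `Kolyvagin1991-ThmCD-primary-unread` travel with it), and on the
Gss2 leaf `E[3]` IS irreducible (`irr_of_subGss_of_ne_two`); and (ii) is, for the twist `Wd` — which lies on the SAME leaf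
(`RamifiedPairUpperBound.leaf_twist_of_heegner`: non-CM, `Addv Wd 3`, `SubGss Wd 3` at an odd-discriminant Heegner field) with
`r_an(Wd) = 0` — precisely an instance of the route's own member U₀ = item 26024 `LeafRankZeroUpperAtThree`
(`Typed.MissingUpperBoundAt Wd 3`). Hence:

* §5  `twist_le_half_of_missingUpperBoundAt` — `MissingUpperBoundAt Wd p` at analytic rank `0` in the `L(Wd,1)/Ω` currency of
  the road (the shape Kato's fact delivered): `∃ q, L(Wd,1)/Ω = q ∧ ord_p #Ш(Wd) + ord_p ∏c(Wd) − 2·ord_p #Wd(ℚ)_tors ≤ ord_p q`.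
* §6  `adjustedIndexBound_of_certificate_of_structIrr` — k1-c3x Part 17a with the Matar–Nekovář fact: ONE certificate of
  adjusted depth ⟹ the ADJUSTED STEP L at the datum, under `E[p]` irreducible (no tower).
* §7  `missingLowerBoundAt_three_rankOne_gss_of_adjustedIndexBound_of_upperTwist` — p610432 §0 with the twist's upper half taken
  as `MissingUpperBoundAt Wd 3` instead of Kato + tower.
* §8  `missingLowerBoundAt_three_rankOne_gss_of_structIrrCertificate_of_upperTwist` — POINTWISE door on ANY Gss2 rank-one row
  (no image binder at all): seven named facts ∧ ONE certificate of adjusted depth at ONE split frame ∧ U₀(Wd) ⟹ L₁(E).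
* §9  CLASS LEVEL: `gss2LowerAtThreeRankOne_allRows_of_exists_certificate_of_leafRankZeroUpper` (L₁ on EVERY row of the leaf ⟸
  seven facts ∧ [per row SOME odd split frame with SOME certificate of adjusted depth] ∧ U₀ 26024 BY NAME) and the `3Nn` form
  `gss2LowerAtThreeRankOne_nonSurjRows_of_exists_certificate_of_leafRankZeroUpper`.
* §10 BY NAME: **`gss2LowerAtThreeRankOneNonTower_of_structIrr_of_certificates3Nn_of_leafRankZeroUpper`** — the declared residual
  NT 27201 ⟸ seven named facts (six of PUB 27199 + the Matar–Nekovář fact) ∧ A₃ₙₙ (the certificate statement of A 27200 asked on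
  the `3Nn` rows, at an odd-discriminant frame) ∧ U₀ 26024; and **`gss2LowerAtThreeRankOne_of_pub_of_structIrr_of_certificatesAll_of_leafRankZeroUpper`**
  — L₁ 26021 ⟸ the same facts ∧ A′ (certificates on ALL rows, odd frames) ∧ U₀ 26024. RESHAPE DATUM for the planner: the
  residual NT can be RETIRED in favour of {A₃ₙₙ (same currency as A: T1⁻ at an additive 3, per-pair certifiable), U₀ 26024
  (already a member of `closes`), one CITED fact already in the tree}.

References: [cite: MatarNekovar2019, Thm. 0.7 (p. 456) and §0.11 (p. 457)] [cite: Cha2005, Thm. 21, Lemma 22–23, Rmk. 25]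
[cite: McCallumLMS1991, §5 Lemma 5.1 (p. 303), Cor. 5.6 (p. 310)] [cite: Kolyvagin1991StructureSha, Thm. C, Thm. D]
[cite: JetchevSkinnerWan2017, §7.4.1 (pp. 29–31)] [cite: GrossZagier1986, Thm. I.(6.3), V.§2] [cite: Darmon2004, Thm. 3.6]
[cite: GrossLMS1991, §4 (4.1)] [cite: Miller2011LMS, Def. 1.1] [cite: Serre1972, §1.11 Prop. 12].
-/

-- D-0017: single-problem summit, so `Summit.BirchSwinnertonDyer.BirchSwinnertonDyer.…` repeats a namespace BY DESIGN.
set_option linter.dupNamespace false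
set_option autoImplicit false

noncomputable section

open scoped Classical NumberField

open WeierstrassCurve NumberField IsDedekindDomain
  Literature.NumberTheory.EllipticCurves Literature.NumberTheory.EllipticCurves.ModularForms
  Literature.NumberTheory.EllipticCurves.Rank1Residual
  Literature.NumberTheory.EllipticCurves.Rank1Residual.Typed
  Summit.BirchSwinnertonDyer.Rank1Residual
  Summit.BirchSwinnertonDyer.Rank1Residual.Additive
  Summit.BirchSwinnertonDyer.Rank1Residual.X11b
  Summit.BirchSwinnertonDyer.Rank1Residual.GaloisImage
  Summit.BirchSwinnertonDyer.BirchSwinnertonDyer.Theorems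
  Summit.BirchSwinnertonDyer.BirchSwinnertonDyer.Theorems.AdditiveBranchIMCGordTwoRankOne

namespace Summit.BirchSwinnertonDyer.BirchSwinnertonDyer.Theorems.RamifiedPairLowerBound

/-! ## §5 The twist's upper half in the road's currency -/

/-- **`MissingUpperBoundAt Wd p` at analytic rank `0`, in the `L(Wd,1)/Ω` currency**: if `#Ш(Wd)_an = q ∈ ℚ` with
`ord_p #Ш(Wd) ≤ ord_p q` and `L(Wd,1) ≠ 0`, then `L(Wd,1)/Ω_{Wd} = q·∏c/#tors² =: q₀ ∈ ℚ` and
`ord_p #Ш(Wd) + ord_p ∏c(Wd) − 2·ord_p #Wd(ℚ)_tors ≤ ord_p q₀` (`Reg = 1` by GZK at `r_an = 0`). This is exactly the shape Kato's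
Tamagawa-exact fact delivers on the tower rows (k1-c3x `twist_le_half_of_katoTamagawaExact`). Bookkeeping. [cite: Miller2011LMS, Def. 1.1] -/
theorem twist_le_half_of_missingUpperBoundAt
    (hGZK : rank_eq_analyticRank_of_analyticRank_le_one) (hmod : hasEntireLFunction_rat)
    (Wd : WeierstrassCurve ℚ) [Wd.IsElliptic] (p : ℕ) [Fact p.Prime]
    (hL : Wd.entireLFunction 1 ≠ 0) (hU : MissingUpperBoundAt Wd p) :
    ∃ q : ℚ, Wd.entireLFunction 1 / (Wd.realPeriodRat : ℂ) = (q : ℂ) ∧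
      (padicValNat p Wd.shaOrder : ℤ) + padicValNat p Wd.tamagawaProduct -
        2 * padicValNat p Wd.torsionOrder ≤ padicValRat p q := by
  have hrd : Wd.analyticRank = 0 := (Wd.analyticRank_eq_zero_iff_holds (hmod Wd)).2 hL
  have hmw0 : Wd.mordellWeilRank = 0 := by rw [(hGZK Wd (by rw [hrd]; exact zero_le_one)).1, hrd]
  have hΩpos : 0 < Wd.realPeriodRat := Wd.realPeriodRat_pos_holds
  have htpos : 0 < Wd.torsionOrder := Wd.torsionOrder_pos_holds
  have hcpos : 0 < Wd.tamagawaProduct := Wd.tamagawaProduct_pos_holds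
  have hΩ : (Wd.realPeriodRat : ℂ) ≠ 0 := by exact_mod_cast hΩpos.ne'
  have ht : (Wd.torsionOrder : ℂ) ≠ 0 := by exact_mod_cast htpos.ne'
  have hc : (Wd.tamagawaProduct : ℂ) ≠ 0 := by exact_mod_cast hcpos.ne'
  obtain ⟨q, hq, hle⟩ := hU
  rw [shaAn_def, Wd.leadingLCoeff_eq_of_analyticRank_eq_zero hrd, Wd.regulator_eq_one_of_rank_zero hmw0] at hq
  simp only [Complex.ofReal_one, mul_one] at hq
  -- `q ≠ 0` because `L(Wd,1) ≠ 0`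
  have hq0 : q ≠ 0 := by
    intro h0
    rw [h0] at hq
    push_cast at hq
    rw [div_eq_zero_iff] at hq
    rcases hq with h | h
    · exact (mul_ne_zero hL (pow_ne_zero 2 ht)) h
    · exact (mul_ne_zero hΩ hc) h
  refine ⟨q * Wd.tamagawaProduct / (Wd.torsionOrder : ℚ) ^ 2, ?_, ?_⟩
  · push_cast
    rw [← hq]
    field_simp
  · have htq : (Wd.torsionOrder : ℚ) ≠ 0 := by exact_mod_cast htpos.ne'
    have hcq : (Wd.tamagawaProduct : ℚ) ≠ 0 := by exact_mod_cast hcpos.ne'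
    have hval : padicValRat p (q * Wd.tamagawaProduct / (Wd.torsionOrder : ℚ) ^ 2) =
        padicValRat p q + padicValNat p Wd.tamagawaProduct - 2 * padicValNat p Wd.torsionOrder := by
      rw [padicValRat.div (mul_ne_zero hq0 hcq) (pow_ne_zero 2 htq), padicValRat.mul hq0 hcq,
        padicValRat.pow (Wd.torsionOrder : ℚ), padicValRat.of_nat, padicValRat.of_nat]
      simp only [Nat.cast_ofNat]
    rw [hval]
    linarith

/-! ## §6 The ADJUSTED STEP L at a datum from ONE certificate, under IRREDUCIBILITY (Matar–Nekovář 2019 Thm. 0.7 / §0.11) -/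

/-- **Bookkeeping: the order form of the Matar–Nekovář fact** — `2(M₀ − M) ≤ ord_p #Ш(E_K/K)[p^∞]` from one certificate, when
that group is finite. Word for word `two_mul_sub_le_padicValNat_card_sha_primary_of_certificate` with the irreducible-image fact.
[cite: MatarNekovar2019, Thm. 0.7 (p. 456) and §0.11 (p. 457)] [cite: McCallumLMS1991, §5 Cor. 5.6 (p. 310)] -/
theorem two_mul_sub_le_padicValNat_card_sha_primary_of_certificate_of_structIrr
    (h : MatarNekovar2019.thm07_pow_dvd_card_sha_primary_of_certificate_of_irreducible)
    (W : WeierstrassCurve ℚ) [W.IsElliptic] [W.IsGloballyMinimal] [NeZero (W.conductorNorm ℤ)]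
    (hCM : ¬ W.HasCM) (K : Type) [Field K] [NumberField K] (hK : IsImaginaryQuadratic K)
    (h3 : NumberField.discr K ≠ -3) (h4 : NumberField.discr K ≠ -4)
    (hH : SatisfiesHeegnerHypothesis (W.conductorNorm ℤ) K)
    (p : ℕ) [Fact p.Prime] (hp : p ≠ 2) (hirr : W.HasIrreducibleModPGaloisRep p)
    (Dt : ModularParametrizationData W (W.conductorNorm ℤ)) (β : ℤ) (ι : K →+* ℂ)
    (d₁ : KolyvaginHeegnerData Dt β ι 1) (P : (W.baseChange K).toAffine.Point)
    (hP : d₁.toGeomPoints d₁.derivedPoint = toGeomPoints (W.baseChange K) P)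
    (hPinf : ¬ IsOfFinAddOrder P) {M₀ : ℕ}
    (hdiv : ∃ Q : (W.baseChange K).toAffine.Point, ((p ^ M₀ : ℕ) : ℤ) • Q = P)
    (hndiv : ¬ ∃ Q : (W.baseChange K).toAffine.Point, ((p ^ (M₀ + 1) : ℕ) : ℤ) • Q = P)
    {n M : ℕ} (d : KolyvaginHeegnerData Dt β ι n) (hn : Squarefree n)
    (hℓ : ∀ ℓ ∈ n.primeFactors, Zhang2014.IsKolyvaginPrime (W.conductorNorm ℤ) W K p ℓ ∧
      M + 1 ≤ Zhang2014.kolyvaginIndex W p ℓ)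
    (hcert : ¬ ∃ Q : (W.baseChange (ringClassField K ι n)).toAffine.Point,
      ((p ^ (M + 1) : ℕ) : ℤ) • Q = d.derivedPoint)
    [Finite (AddCommGroup.primaryComponent (W.baseChange K).sha p)] :
    2 * (M₀ - M) ≤ padicValNat p (Nat.card (AddCommGroup.primaryComponent (W.baseChange K).sha p)) := by
  have hdvd := h W hCM K hK h3 h4 hH p hp hirr Dt β ι d₁ P hP hPinf M₀ hdiv hndiv n M d hn hℓ hcert
  have hpos : Nat.card (AddCommGroup.primaryComponent (W.baseChange K).sha p) ≠ 0 := Nat.card_pos.ne'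
  exact (padicValNat_dvd_iff_le hpos).mp hdvd

/-- **STEP L′ at a datum from ONE Kolyvagin certificate of ADJUSTED depth, under IRREDUCIBILITY of `E[p]`** (k1-c3x Part 17a
`HeegnerKolyvagin.adjustedIndexBound_of_certificate_of_mccallum` word for word, with Kolyvagin's structure theorem taken as the
Matar–Nekovář irreducible-image fact instead of the tower-image McCallum fact). Frame: `W/ℚ` globally minimal non-CM, `K` imaginary
quadratic Heegner for `N_E` with `d_K ∉ {−3,−4}`, `p` odd with `E[p]` IRREDUCIBLE, the conductor-`1` datum `d₁` with
`P_1 = y_K = P ∈ E(K)` of infinite order, `E(K)` of rank one without `p`-torsion, `Ш(E/K)` finite, `p^{M₀} ∥ P`. CERTIFICATE: a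
datum `d` of square-free conductor `n` (prime factors Kolyvagin primes of index `≥ M + 1`) with `P_n ∉ p^{M+1}E(K[n])`, and DEPTH
`2M ≤ ord_p ∏c(E) + ord_p ∏c(Wd) + 2·ord_p c(Dt)`. CONCLUSION: `2·ord_p[E(K):ℤP] ≤ ord_p #Ш(E/K) + ord_p ∏c(E) + ord_p ∏c(Wd) +
2·ord_p c(Dt)`. CONDITIONAL on `hMN`. [cite: MatarNekovar2019, Thm. 0.7 (p. 456) and §0.11 (p. 457)]
[cite: McCallumLMS1991, §5 Lemma 5.1 (p. 303) and Cor. 5.6 (p. 310)] [cite: JetchevSkinnerWan2017, §7.4.1 (pp. 30–31)] -/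
theorem adjustedIndexBound_of_certificate_of_structIrr
    (hMN : MatarNekovar2019.thm07_pow_dvd_card_sha_primary_of_certificate_of_irreducible)
    (W : WeierstrassCurve ℚ) [W.IsElliptic] [W.IsGloballyMinimal] [NeZero (W.conductorNorm ℤ)]
    (hCM : ¬ W.HasCM) (K : Type) [Field K] [NumberField K] (hK : IsImaginaryQuadratic K)
    (h3 : NumberField.discr K ≠ -3) (h4 : NumberField.discr K ≠ -4)
    (hH : SatisfiesHeegnerHypothesis (W.conductorNorm ℤ) K)
    (p : ℕ) [Fact p.Prime] (hp2 : p ≠ 2) (hirr : W.HasIrreducibleModPGaloisRep p)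
    (Dt : ModularParametrizationData W (W.conductorNorm ℤ)) (β : ℤ) (ι : K →+* ℂ)
    (d₁ : KolyvaginHeegnerData Dt β ι 1) (P : (W.baseChange K).toAffine.Point)
    (hPd : d₁.toGeomPoints d₁.derivedPoint = toGeomPoints (W.baseChange K) P)
    (hPinf : ¬ IsOfFinAddOrder P)
    (hrank : (W.baseChange K).mordellWeilRank = 1)
    (hiv : ∀ x : (W.baseChange K).toAffine.Point, p • x = 0 → x = 0)
    [Finite (W.baseChange K).sha] {M₀ : ℕ}
    (hdiv : ∃ Q : (W.baseChange K).toAffine.Point, ((p ^ M₀ : ℕ) : ℤ) • Q = P)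
    (hndiv : ¬ ∃ Q : (W.baseChange K).toAffine.Point, ((p ^ (M₀ + 1) : ℕ) : ℤ) • Q = P)
    {n M : ℕ} (d : KolyvaginHeegnerData Dt β ι n) (hn : Squarefree n)
    (hℓ : ∀ ℓ ∈ n.primeFactors, Zhang2014.IsKolyvaginPrime (W.conductorNorm ℤ) W K p ℓ ∧
      M + 1 ≤ Zhang2014.kolyvaginIndex W p ℓ)
    (hcert : ¬ Three.Koly.PDiv d p (M + 1))
    (Wd : WeierstrassCurve ℚ)
    (hM : (2 * M : ℤ) ≤ padicValNat p W.tamagawaProduct + padicValNat p Wd.tamagawaProduct +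
      2 * padicValRat p (Dt.c : ℚ)) :
    (2 * padicValNat p (AddSubgroup.zmultiples P).index : ℤ) ≤
      padicValNat p (W.baseChange K).shaOrder + padicValNat p W.tamagawaProduct +
        padicValNat p Wd.tamagawaProduct + 2 * padicValRat p (Dt.c : ℚ) := by
  -- adapted from k1-c3x `adjustedIndexBound_of_certificate_of_mccallum` (Part 17a), `hMc` ↦ `hMN`, tower ↦ `Irr`
  have hle : 2 * (M₀ - M) ≤
      padicValNat p (Nat.card (AddCommGroup.primaryComponent (W.baseChange K).sha p)) :=
    two_mul_sub_le_padicValNat_card_sha_primary_of_certificate_of_structIrr hMN W hCM K hK h3 h4 hH p hp2 hirr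
      Dt β ι d₁ P hPd hPinf hdiv hndiv d hn hℓ hcert
  have hsha : padicValNat p (W.baseChange K).shaOrder =
      padicValNat p (Nat.card (AddCommGroup.primaryComponent (W.baseChange K).sha p)) :=
    Three.Koly.padicValNat_shaOrder_eq (W.baseChange K) p
  haveI : Finite (AddCommGroup.torsion (W.baseChange K).toAffine.Point) :=
    WeierstrassCurve.finite_torsion_point (W := W.baseChange K)
  obtain ⟨c, Q, hcQ, hcker⟩ :=
    RankOne.exists_coord_of_mordellWeilRank_eq_one (W.baseChange K) hrank
  have hidx : padicValNat p (AddSubgroup.zmultiples P).index = M₀ :=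
    Three.Koly.padicValNat_index_zmultiples_eq_of_divisibility c Q hcQ hcker hiv P hdiv hndiv
  have e1 : (2 * M₀ : ℤ) ≤ padicValNat p (W.baseChange K).shaOrder + 2 * M := by
    rw [hsha]; omega
  rw [hidx]
  linarith

/-! ## §7 The pointwise door at a Gss2 prime `3` with the TWIST'S UPPER HALF as a typed input (no Kato, no tower) -/

/-- **`MissingLowerBoundAt E 3` at ONE split Heegner datum from the ADJUSTED STEP L and the UPPER half of the twist.** p610432
§0 `missingLowerBoundAt_three_rankOne_gss_of_adjustedIndexBound` word for word, except that the rank-`0` twist's `≤`-half is the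
typed input `hUd : MissingUpperBoundAt Wd 3` (the route's member U₀ at `Wd`) instead of Kato 14.5 (3) + 14.16 (2) under 3-adic
surjectivity. Data and the other binders as there: `W/ℚ` globally minimal, Gss2 at `3`, `r_an = 1`; `K` imaginary quadratic
Heegner for `N_W` with `3 ∤ #𝓞_K^×`, `L(W^{(d_K)},1) ≠ 0`; `P ∈ E(K)` over the complex Heegner point of `(Dt, H, ι)`; `Wd = Cd •
W^{(d_K)}` globally minimal; published `hGZ hKo hGZK hmod`; `hL'` the adjusted STEP L granted finiteness of `Ш(E/K)`.
[cite: JetchevSkinnerWan2017, §7.4.1 (pp. 29–31)] [cite: GrossZagier1986, Thm. I.(6.3) and V.§2] [cite: Miller2011LMS, Def. 1.1] -/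
theorem missingLowerBoundAt_three_rankOne_gss_of_adjustedIndexBound_of_upperTwist
    (W : WeierstrassCurve ℚ) [W.IsElliptic] [W.IsGloballyMinimal] [NeZero (W.conductorNorm ℤ)]
    (K : Type) [Field K] [NumberField K]
    (Dt : ModularParametrizationData W (W.conductorNorm ℤ))
    (H : HeegnerDatum (W.conductorNorm ℤ) (NumberField.discr K)) (ι : K →+* ℂ)
    (P : (W.baseChange K).toAffine.Point)
    (hGZ : gross_zagier (W.conductorNorm ℤ) W K) (hKo : kolyvagin (W.conductorNorm ℤ) W K)
    (hGZK : rank_eq_analyticRank_of_analyticRank_le_one) (hmod : hasEntireLFunction_rat)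
    (hadd : Addv W 3) (hr : W.analyticRank = 1)
    (hK : IsImaginaryQuadratic K) (hHN : SatisfiesHeegnerHypothesis (W.conductorNorm ℤ) K)
    (hP : WeierstrassCurve.Affine.Point.map ι.toRatAlgHom P = heegnerPointComplex Dt H)
    (hμ : ¬ 3 ∣ Units.torsionOrder K)
    (hLt : (W.quadraticTwist (NumberField.discr K : ℚ)).entireLFunction 1 ≠ 0)
    (Wd : WeierstrassCurve ℚ) [Wd.IsElliptic] [Wd.IsGloballyMinimal] (Cd : VariableChange ℚ)
    (hWd : Cd • W.quadraticTwist (NumberField.discr K : ℚ) = Wd)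
    (hUd : MissingUpperBoundAt Wd 3)
    (hL' : Finite (W.baseChange K).sha →
      (2 * padicValNat 3 (AddSubgroup.zmultiples P).index : ℤ) ≤
        padicValNat 3 (W.baseChange K).shaOrder + padicValNat 3 W.tamagawaProduct +
          padicValNat 3 Wd.tamagawaProduct + 2 * padicValRat 3 (Dt.c : ℚ)) :
    MissingLowerBoundAt W 3 := by
  -- adapted from p610432 §0 (`…_of_adjustedIndexBound`): Kato on the twist ↦ the typed input `hUd`
  haveI : Fact (Nat.Prime 3) := ⟨Nat.prime_three⟩
  have hp2 : (3 : ℕ) ≠ 2 := by decide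
  have hD0 : (NumberField.discr K : ℚ) ≠ 0 := by exact_mod_cast NumberField.discr_ne_zero K
  haveI hEt : (W.quadraticTwist (NumberField.discr K : ℚ)).IsElliptic := W.isElliptic_quadraticTwist hD0
  have hu : padicValRat 3 (Cd.u : ℚ) = 0 :=
    HeegnerKolyvagin.padicValRat_u_eq_zero_of_twist_minimal' W 3 K hK hHN hadd.1 Cd hWd
  have hLt' : (W.quadraticTwist (NumberField.discr K : ℚ)).entireLFunction = Wd.entireLFunction := by
    rw [← hWd, entireLFunction_smul]
  have hLd1 : Wd.entireLFunction 1 ≠ 0 := by rw [← hLt']; exact hLt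
  -- the twist's `≤`-half in the road's currency, from `MissingUpperBoundAt Wd 3`
  obtain ⟨qd, hqd, hvqd⟩ := twist_le_half_of_missingUpperBoundAt hGZK hmod Wd 3 hLd1 hUd
  -- the Manin-kept Gross–Zagier bookkeeping identity (k1-c3x Part 4), and the adjusted bound
  obtain ⟨-, hfinK, hsha, q, hq, hval⟩ := HeegnerKolyvagin.exists_shaAn_padicVal_eq_of_heegner_maninKept W 3
    (W.conductorNorm ℤ) K Dt H ι P hGZ hKo hGZK hmod hK hHN hP hp2 hμ hr hLt Wd Cd hWd hu qd hqd
  have e1 := hL' hfinK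
  refine ⟨q, hq, ?_⟩
  have e2 : (padicValNat 3 (W.baseChange K).shaOrder : ℤ) =
      padicValNat 3 W.shaOrder + padicValNat 3 Wd.shaOrder := by exact_mod_cast hsha
  linarith

/-! ## §8 The pointwise door on ANY Gss2 rank-one row: seven named facts ∧ ONE certificate ∧ U₀(Wd) ⟹ L₁(E) -/

/-- **The LOWER half of ANY rank-one Gss2-at-3 row from ONE certificate at ONE split frame and the UPPER half of the twist — NO
image hypothesis.** p618012 §11 `missingLowerBoundAt_three_rankOne_gss_of_mccallumCertificate` word for word, with three
changes: (1) Kolyvagin's structure theorem is the IRREDUCIBLE-image fact `hMN`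
(`MatarNekovar2019.thm07_pow_dvd_card_sha_primary_of_certificate_of_irreducible`), its binder `E[3]` irreducible being AUTOMATIC
on the Gss2 leaf (`irr_three_of_subGss`); (2) non-CM is a HYPOTHESIS (`hCM`; no longer derivable without surjectivity — CM curves do
carry Cartan-normaliser images); (3) the twist's upper half is the typed input `hUd : MissingUpperBoundAt Wd 3` (Kato's (12.5.2) is
unavailable off the tower). Everything else — `d_K ∉ {−3,−4}`, `3 ∤ #𝓞_K^×`, `y_K = P` non-torsion, rank one, `Ш(E/K)` finite,
`E(K)[3] = 0`, `3^{M₀} ∥ P` — is DERIVED as there. [cite: MatarNekovar2019, Thm. 0.7 (p. 456) and §0.11 (p. 457)]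
[cite: McCallumLMS1991, §5 Lemma 5.1 (p. 303) and Cor. 5.6 (p. 310)] [cite: JetchevSkinnerWan2017, §7.4.1 (pp. 29–31)]
[cite: Darmon2004, Thm. 3.6] [cite: GrossLMS1991, §4 (4.1)] [cite: GrossZagier1986, Thm. I.(6.3) and V.§2] -/
theorem missingLowerBoundAt_three_rankOne_gss_of_structIrrCertificate_of_upperTwist
    (W : WeierstrassCurve ℚ) [W.IsElliptic] [W.IsGloballyMinimal] [NeZero (W.conductorNorm ℤ)]
    (K : Type) [Field K] [NumberField K]
    (Dt : ModularParametrizationData W (W.conductorNorm ℤ))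
    (H : HeegnerDatum (W.conductorNorm ℤ) (NumberField.discr K)) (ι : K →+* ℂ)
    (P : (W.baseChange K).toAffine.Point)
    (hGZ : gross_zagier (W.conductorNorm ℤ) W K) (hKo : kolyvagin (W.conductorNorm ℤ) W K)
    (hGZK : rank_eq_analyticRank_of_analyticRank_le_one) (hmod : hasEntireLFunction_rat)
    (hrec : heegnerPointOfConductor_one_galoisConj (W.conductorNorm ℤ) W K)
    (h36 : phi_heegnerTau_mem_range_map_singularModuliField (W.conductorNorm ℤ) W K)
    (hMN : MatarNekovar2019.thm07_pow_dvd_card_sha_primary_of_certificate_of_irreducible)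
    (hCM : ¬ W.HasCM) (hadd : Addv W 3) (hsub : SubGss W 3) (hr : W.analyticRank = 1)
    (hK : IsImaginaryQuadratic K) (hHN : SatisfiesHeegnerHypothesis (W.conductorNorm ℤ) K)
    (hP : WeierstrassCurve.Affine.Point.map ι.toRatAlgHom P = heegnerPointComplex Dt H)
    (hLt : (W.quadraticTwist (NumberField.discr K : ℚ)).entireLFunction 1 ≠ 0)
    (Wd : WeierstrassCurve ℚ) [Wd.IsElliptic] [Wd.IsGloballyMinimal] (Cd : VariableChange ℚ)
    (hWd : Cd • W.quadraticTwist (NumberField.discr K : ℚ) = Wd)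
    (hUd : MissingUpperBoundAt Wd 3)
    {M : ℕ} (hcert : Three.Koly.CertificateAt Dt H.β ι 3 M)
    (hM : (2 * M : ℤ) ≤ padicValNat 3 W.tamagawaProduct + padicValNat 3 Wd.tamagawaProduct +
      2 * padicValRat 3 (Dt.c : ℚ)) :
    MissingLowerBoundAt W 3 := by
  -- adapted from p618012 §11 (`…_of_mccallumCertificate`): `hMc`/tower/Kato ↦ `hMN`/`Irr`/`hUd`
  have hp2 : (3 : ℕ) ≠ 2 := by decide
  -- `3 ∣ N_W` splits in `K`: `3 ∤ d_K`, `3 ∤ #𝓞_K^×`, `d_K ≠ -3`; and `d_K ≠ -4` since `β² ≡ d_K (mod 3)`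
  have h3N : 3 ∣ W.conductorNorm ℤ :=
    (W.dvd_conductorNorm_iff_not_hasGoodReductionAtPrime 3).mpr (not_good_of_addv W 3 hadd)
  obtain ⟨hd3, hμ⟩ := X11b.Three.not_dvd_discr_and_not_dvd_torsionOrder_of_heegner hK hHN hp2 h3N
  have h3 : NumberField.discr K ≠ -3 := fun h ↦ hd3 (h ▸ ⟨-1, by norm_num⟩)
  have h4 : NumberField.discr K ≠ -4 := by
    intro hK4
    have h12 : (3 : ℤ) ∣ 4 * (W.conductorNorm ℤ : ℤ) := Dvd.dvd.mul_left (by exact_mod_cast h3N) 4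
    have h3d : (3 : ℤ) ∣ H.β ^ 2 - NumberField.discr K := dvd_trans h12 H.dvd_sq_sub
    have hcast : ((H.β ^ 2 - NumberField.discr K : ℤ) : ZMod 3) = 0 :=
      (ZMod.intCast_zmod_eq_zero_iff_dvd _ 3).mpr h3d
    have hdK : ((NumberField.discr K : ℤ) : ZMod 3) = -4 := by rw [hK4]; push_cast; ring
    push_cast at hcast
    rw [hdK] at hcast
    have key : ∀ b : ZMod 3, b ^ 2 - (-4 : ZMod 3) ≠ 0 := by decide
    exact key _ hcast
  haveI h3p : Fact (Nat.Prime 3) := ⟨Nat.prime_three⟩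
  -- `E[3]` irreducible on the Gss2 leaf (no surjectivity needed; tree `irr_of_subGss_of_ne_two`)
  have hirr : Irr W 3 := irr_of_subGss_of_ne_two W 3 hp2 hadd hsub
  -- the conductor-`1` Kolyvagin–Heegner datum (Darmon Thm. 3.6) with `P_1 = y_K = P` in `E(K̄)` (Shimura reciprocity)
  obtain ⟨d₁⟩ := nonempty_kolyvaginHeegnerData_one_of_darmon36 h36 hK Dt H.β ι H.dvd_sq_sub
  have hPd : d₁.toGeomPoints d₁.derivedPoint = toGeomPoints (W.baseChange K) P :=
    KolyvaginBottom.toGeomPoints_derivedPoint_one_eq hrec hK hHN hP d₁ rfl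
  -- `P` non-torsion (Gross–Zagier), rank one and `Ш(E/K)` finite (Kolyvagin)
  have hPinf : ¬ IsOfFinAddOrder P :=
    not_isOfFinAddOrder_of_heegner_of_analyticRank_eq_one W (W.conductorNorm ℤ) K Dt H ι P hGZ hmod hr hK hHN hLt hP
  obtain ⟨hrank, hSha⟩ := hKo hK hHN ⟨Dt, H, ι, hP⟩ hPinf
  haveI : Finite (W.baseChange K).sha := hSha
  -- `E(K)[3] = 0` (`E[3]` irreducible over the imaginary quadratic `K`)
  have hbot := torsionBy_eq_bot_of_isImaginaryQuadratic_of_hasIrreducibleModPGaloisRep W K hK Nat.prime_three hirr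
  have hiv : ∀ x : (W.baseChange K).toAffine.Point, (3 : ℕ) • x = 0 → x = 0 := fun x hx ↦ by
    have hmem : x ∈ AddSubgroup.torsionBy (W.baseChange K).toAffine.Point (((3 : ℕ) : ℕ) : ℤ) := by
      rw [mem_torsionBy_iff, natCast_zsmul]
      exact hx
    rw [hbot] at hmem
    exact hmem
  -- `3^{M₀} ∥ P` in `E(K)` (Mordell–Weil: `E(K)` is finitely generated, `P` non-torsion)
  haveI : Module.Finite ℤ (W.baseChange K).toAffine.Point := (W.baseChange K).module_finite_point_holds
  obtain ⟨M₀, x₀, hx₀, hmax⟩ := exists_pow_smul_eq_and_forall_ne hPinf (p := 3) Nat.prime_three.two_le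
  have hdiv : ∃ Q : (W.baseChange K).toAffine.Point, ((3 ^ M₀ : ℕ) : ℤ) • Q = P :=
    ⟨x₀, by rw [natCast_zsmul]; exact hx₀⟩
  have hndiv : ¬ ∃ Q : (W.baseChange K).toAffine.Point, ((3 ^ (M₀ + 1) : ℕ) : ℤ) • Q = P := by
    rintro ⟨Q, hQ⟩
    exact hmax Q (by rw [← natCast_zsmul]; exact hQ)
  -- the certificate: `n ∈ S_r(M+1)` with `P_n ∉ 3^{M+1} E(K[n])`; §6 gives the ADJUSTED STEP L at the datum
  obtain ⟨n, r, d, hn, hnd⟩ := hcert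
  have hL' : (2 * padicValNat 3 (AddSubgroup.zmultiples P).index : ℤ) ≤
      padicValNat 3 (W.baseChange K).shaOrder + padicValNat 3 W.tamagawaProduct +
        padicValNat 3 Wd.tamagawaProduct + 2 * padicValRat 3 (Dt.c : ℚ) :=
    adjustedIndexBound_of_certificate_of_structIrr hMN W hCM K hK h3 h4 hHN 3 hp2 hirr Dt H.β ι d₁ P
      hPd hPinf hrank hiv hdiv hndiv d hn.1 hn.2.2 hnd Wd hM
  -- §7: the pointwise door with the twist's upper half
  exact missingLowerBoundAt_three_rankOne_gss_of_adjustedIndexBound_of_upperTwist W K Dt H ι P hGZ hKo hGZK hmod hadd hr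
    hK hHN hP hμ hLt Wd Cd hWd hUd fun _ ↦ hL'


end Summit.BirchSwinnertonDyer.BirchSwinnertonDyer.Theorems.RamifiedPairLowerBound

end
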